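import Mathlib.AlgebraicGeometry.EllipticCurve.Affine.Point
import Mathlib.NumberTheory.NumberField.Basic
import Mathlib.NumberTheory.Padics.HeightOneSpectrum
import Mathlib.NumberTheory.Padics.RingHoms
import HarnessLib

/-!
# `E(ℚ_v)[n] ≅ E(ℚ_p)[n]`: the points of `E/ℚ` over the completion `ℚ_v` (`v ∋ p`) and over `ℚ_[p]`

Topic `NumberTheory/EllipticCurves`; namespace `WeierstrassCurve` (dot notation). Theorems only, from
Mathlib alone: **no definition and no named fact is introduced** (D-0014 / D-0026).

The tree speaks of the `ℚ_p`-points of an elliptic curve `E/ℚ` in two currencies: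

* the completion `ℚ_v = v.adicCompletion ℚ` at the finite place `v` of `ℚ` above `p` — the currency
  of the Selmer machinery (`Selmer.lean`, `LocalKummerMap.lean`, `SelmerLocalRestrictionKernel.lean`,
  e.g. the hypothesis `htors : #E(ℚ_v)[p] = 1` of
  `WeierstrassCurve.natCard_selmerGroup_le_prime_mul_of_natCard_torsion_eq_one`
  (`⟹ #Sel⁽ᵖ⁾(E/ℚ) ≤ p · #Z_v(E)`)), and
* Mathlib's `ℚ_[p]` — the currency of every local-torsion COMPUTATION in the tree (the Tate-parameter
  test `natCard_ker_nsmul_eq_one_iff_not_exists_pow_eq_tateParameter` of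
  `TateParameterPrimeTorsion.lean`: split multiplicative odd `p`, `#E(ℚ_p)[p] = 1 ⟺ q_E ∉ (ℚ_p)^p`;
  the summit cone's `X11b.LocalTorsion.localTorsion_eq_zero_of_mult`: non-split, or `p ∤ v_p(Δ_min)`,
  every `p ≥ 3`, `∀ P ∈ E(ℚ_p), pP = O → P = O`).

Along Mathlib's continuous `ℚ`-algebra isomorphism
`Rat.HeightOneSpectrum.adicCompletion.padicEquiv v : ℚ_v ≃A[ℚ] ℚ_[primesEquiv v]` (and
`primesEquiv v = p` when `p ∈ v`) the groups of points are isomorphic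
(`WeierstrassCurve.Affine.Point.map`, functorial — the construction already used in the tree's
`Literature.Barriers.BirchSwinnertonDyer.pointEquivOfAlgEquiv` and in
`DescentDefectUnboundedMatsunoLemma42Proofs.nonempty_pointsEquiv_padic`, repeated here with Mathlib
imports only), so the `n`-torsion subgroups have the same cardinality and "`E(ℚ_v)[n] = 0`" and
"`E(ℚ_p)[n] = 0`" are one statement. This is the glue that lets a local-torsion vanishing proved over
`ℚ_[p]` discharge the `ℚ_v`-hypothesis of the Selmer bound in one line.

## What is proved

* `WeierstrassCurve.natCard_ker_nsmul_adicCompletion_eq_padic` — **`#E(ℚ_v)[n] = #E(ℚ_p)[n]`** for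
  the place `v ∋ p` of `ℚ` and every `n : ℕ` (`Nat.card` of the kernel of multiplication by `n`).
* `WeierstrassCurve.forall_nsmul_eq_zero_adicCompletion_iff_padic` —
  **`E(ℚ_v)[n] = 0 ⟺ E(ℚ_p)[n] = 0`** in the spelling `∀ P, nP = O → P = O`.
* `WeierstrassCurve.natCard_ker_nsmul_adicCompletion_eq_one_of_forall_padic` —
  `(∀ P ∈ E(ℚ_p), nP = O → P = O) ⟹ #E(ℚ_v)[n] = 1`: the hypothesis `htors` of the Selmer bound
  from a `ℚ_[p]`-currency vanishing.
* `WeierstrassCurve.natCard_ker_nsmul_adicCompletion_eq_one_iff` — `#E(ℚ_v)[n] = 1 ⟺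
  ∀ P ∈ E(ℚ_p), nP = O → P = O`.

Written for the BSD-DENSITY SPRINT of cell `b2b-bsdres` (book `cells/density/CONVERSION-QUEUE.md`,
rows Q4 `hker` / Q4′): on the slice `P = SP′` of the res-cell assembly
`Literature.NumberTheory.EllipticCurves.bsz_rankLeOne_cRank_of_pieces` the binder `hker`
(`#Sel₅(E) ≤ 5 · #Z(E)`) is `natCard_selmerGroup_le_prime_mul_of_natCard_torsion_eq_one` below the one
local input `E(ℚ₅)[5] = 0` — whose printed sources (non-split / `5 ∤ v₅(Δ)`: summit cone; split with
`q_E ∉ (ℚ₅)^5`: the Tate test) are `ℚ_[5]`-currency theorems. Bhargava–Skinner, J. Ramanujan Math.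
Soc. 29 (2014), proof of Lemma 16: "`#E(ℚ_p)/pE(ℚ_p) = p·#E(ℚ_p)[p]`"; Skinner–Zhang arXiv:1407.1099
Thm. 1.1 (b) / Castella's erratum Thm. A′ (2): the hypothesis "`E(ℚ_p)[p] = 0`"; Silverman *AEC*
VII.§3: `E(K)[m]` and `E(K_v)[m]`.

## References

* [BhargavaSkinner2014] M. Bhargava, C. Skinner, *A positive proportion of elliptic curves over `ℚ`
  have rank one*, J. Ramanujan Math. Soc. 29 (2014) = arXiv:1401.0233, Thm. 7 (ii), proof of
  Lemma 16 (chunk p0012 L106–130).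
* [SkinnerZhang2014] C. Skinner, W. Zhang, arXiv:1407.1099v1, Thm. 1.1 (b).
* [SilvermanAEC2009] J. H. Silverman, *The Arithmetic of Elliptic Curves*, 2nd ed. (2009), VII.§3.
-/

noncomputable section

open scoped Classical

namespace WeierstrassCurve

/-! ## Kernels of multiplication by `n` along an additive isomorphism -/

/-- `#A[n] = #B[n]` for isomorphic abelian groups `A ≃+ B` (the isomorphism restricts to the kernels
of multiplication by `n`). [folklore] -/
private theorem natCard_ker_nsmul_congr {A B : Type*} [AddCommGroup A] [AddCommGroup B]
    (φ : A ≃+ B) (n : ℕ) :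
    Nat.card (nsmulAddMonoidHom n : A →+ A).ker = Nat.card (nsmulAddMonoidHom n : B →+ B).ker := by
  refine Nat.card_congr
    { toFun := fun x => ⟨φ x.1, ?_⟩
      invFun := fun y => ⟨φ.symm y.1, ?_⟩
      left_inv := fun x => Subtype.ext (φ.symm_apply_apply x.1)
      right_inv := fun y => Subtype.ext (φ.apply_symm_apply y.1) }
  · have h := x.2
    rw [AddMonoidHom.mem_ker, nsmulAddMonoidHom_apply] at h ⊢
    rw [← map_nsmul, h, map_zero]
  · have h := y.2
    rw [AddMonoidHom.mem_ker, nsmulAddMonoidHom_apply] at h ⊢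
    rw [← map_nsmul, h, map_zero]

/-- `#A[n] = 1 ⟺ ∀ a, n • a = 0 → a = 0`. [folklore] -/
private theorem natCard_ker_nsmul_eq_one_iff_forall {A : Type*} [AddCommGroup A] (n : ℕ) :
    Nat.card (nsmulAddMonoidHom n : A →+ A).ker = 1 ↔ ∀ a : A, n • a = 0 → a = 0 := by
  rw [AddSubgroup.card_eq_one, AddSubgroup.eq_bot_iff_forall]
  simp only [AddMonoidHom.mem_ker, nsmulAddMonoidHom_apply]

/-! ## `E(ℚ_v) ≅ E(ℚ_p)` at the place `v ∋ p` of `ℚ` -/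

section Transport

open Rat.HeightOneSpectrum NumberField IsDedekindDomain

variable (W : WeierstrassCurve ℚ) {p : ℕ} [hp : Fact p.Prime] {v : HeightOneSpectrum (𝓞 ℚ)}

/-- A finite place `v` of `ℚ` containing the rational prime `p` is the place of `p`
(`primesEquiv v = p`: Mathlib's `natGenerator v`, a prime, divides `p`). [folklore] -/
private theorem coe_primesEquiv_eq_of_natCast_mem (hpv : (p : 𝓞 ℚ) ∈ v.asIdeal) :
    ((primesEquiv v : Nat.Primes) : ℕ) = p := by
  have h : natGenerator v ∣ p := by
    rw [natGenerator_dvd_iff, ← map_natCast (Rat.IsIntegralClosure.intEquiv (𝓞 ℚ)) p]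
    exact Ideal.mem_map_of_mem _ hpv
  exact (Nat.prime_dvd_prime_iff_eq (prime_natGenerator v) hp.out).mp h

/-- Base change of points along the `ℚ`-algebra identity is the identity (Mathlib's
`Affine.Point.map_id` is stated for `Algebra.ofId F F`). [folklore] -/
private theorem map_algHom_id_aux {F : Type*} [Field F] [Algebra ℚ F]
    (Q : (W.baseChange F).toAffine.Point) : Affine.Point.map (AlgHom.id ℚ F) Q = Q := by
  cases Q <;> rfl

/-- **`E(ℚ_v) ≅ E(ℚ_p)`** for `E/ℚ` and the finite place `v ∋ p` of `ℚ`: transport of coordinates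
along Mathlib's `ℚ`-algebra isomorphism `padicEquiv v : ℚ_v ≃ ℚ_[primesEquiv v]`, `primesEquiv v = p`
(`Affine.Point.map`, bijective with inverse `Affine.Point.map` of the inverse). [folklore] -/
private theorem nonempty_pointAddEquiv_adicCompletion_padic (hpv : (p : 𝓞 ℚ) ∈ v.asIdeal) :
    Nonempty ((W.baseChange (v.adicCompletion ℚ)).toAffine.Point ≃+
      (W.baseChange ℚ_[p]).toAffine.Point) := by
  obtain rfl : ((primesEquiv v : Nat.Primes) : ℕ) = p := coe_primesEquiv_eq_of_natCast_mem hpv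
  let e : v.adicCompletion ℚ ≃ₐ[ℚ] ℚ_[(primesEquiv v : ℕ)] :=
    (adicCompletion.padicEquiv v).toAlgEquiv
  exact ⟨AddEquiv.ofBijective
    (Affine.Point.map (W' := W) (e : v.adicCompletion ℚ →ₐ[ℚ] ℚ_[(primesEquiv v : ℕ)]))
    ⟨Affine.Point.map_injective (W' := W) _, fun Q ↦
      ⟨Affine.Point.map (W' := W) (e.symm : ℚ_[(primesEquiv v : ℕ)] →ₐ[ℚ] v.adicCompletion ℚ) Q,
        by rw [Affine.Point.map_map, AlgEquiv.comp_symm, map_algHom_id_aux]⟩⟩⟩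

/-- **`#E(ℚ_v)[n] = #E(ℚ_p)[n]`**: for `E/ℚ`, the finite place `v ∋ p` of `ℚ` and `n : ℕ`, the
kernels of multiplication by `n` on the `ℚ_v`-points (`ℚ_v = v.adicCompletion ℚ`, the currency of the
tree's Selmer groups) and on Mathlib's `ℚ_[p]`-points have the same cardinality — `E(ℚ_v) ≅ E(ℚ_p)`
along `padicEquiv v`. This identifies the factor `#E(ℚ_p)[p]` of "`#E(ℚ_p)/pE(ℚ_p) = p·#E(ℚ_p)[p]`"
(Bhargava–Skinner, proof of Lemma 16) in either model of `ℚ_p`.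
[cite: BhargavaSkinner2014, proof of Lemma 16] -/
theorem natCard_ker_nsmul_adicCompletion_eq_padic (hpv : (p : 𝓞 ℚ) ∈ v.asIdeal) (n : ℕ) :
    Nat.card (nsmulAddMonoidHom n : (W.baseChange (v.adicCompletion ℚ)).toAffine.Point →+ _).ker =
      Nat.card (nsmulAddMonoidHom n : (W.baseChange ℚ_[p]).toAffine.Point →+ _).ker := by
  obtain ⟨φ⟩ := W.nonempty_pointAddEquiv_adicCompletion_padic hpv
  exact natCard_ker_nsmul_congr φ n

/-- **`E(ℚ_v)[n] = 0 ⟺ E(ℚ_p)[n] = 0`** in the spelling `∀ P, nP = O → P = O` of the summit cone's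
local-torsion theorems (`X11b.LocalTorsion.localTorsion_eq_zero_of_mult`, `ℚ_[p]`-currency), for the
place `v ∋ p` of `ℚ`. The hypothesis "`E(ℚ_p)[p] = 0`" of Skinner–Zhang Thm. 1.1 (b) / Castella's
erratum Thm. A′ (2), read in the tree's completion `ℚ_v`. [cite: SkinnerZhang2014, Thm. 1.1 (b)]
[cite: BhargavaSkinner2014, proof of Lemma 16] -/
theorem forall_nsmul_eq_zero_adicCompletion_iff_padic (hpv : (p : 𝓞 ℚ) ∈ v.asIdeal) (n : ℕ) :
    (∀ P : (W.baseChange (v.adicCompletion ℚ)).toAffine.Point, n • P = 0 → P = 0) ↔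
      ∀ P : (W.baseChange ℚ_[p]).toAffine.Point, n • P = 0 → P = 0 := by
  rw [← natCard_ker_nsmul_eq_one_iff_forall, ← natCard_ker_nsmul_eq_one_iff_forall,
    W.natCard_ker_nsmul_adicCompletion_eq_padic hpv n]

/-- **`#E(ℚ_v)[n] = 1 ⟺ E(ℚ_p)[n] = 0`** (`∀ P ∈ E(ℚ_p), nP = O → P = O`), for the place `v ∋ p`:
the cardinality hypothesis `htors` of `natCard_selmerGroup_le_prime_mul_of_natCard_torsion_eq_one`
read over Mathlib's `ℚ_[p]`. [cite: BhargavaSkinner2014, proof of Lemma 16] -/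
theorem natCard_ker_nsmul_adicCompletion_eq_one_iff (hpv : (p : 𝓞 ℚ) ∈ v.asIdeal) (n : ℕ) :
    Nat.card (nsmulAddMonoidHom n :
        (W.baseChange (v.adicCompletion ℚ)).toAffine.Point →+ _).ker = 1 ↔
      ∀ P : (W.baseChange ℚ_[p]).toAffine.Point, n • P = 0 → P = 0 := by
  rw [W.natCard_ker_nsmul_adicCompletion_eq_padic hpv n, natCard_ker_nsmul_eq_one_iff_forall]

/-- **`E(ℚ_p)[n] = 0 ⟹ #E(ℚ_v)[n] = 1`**: a local-torsion vanishing proved over Mathlib's `ℚ_[p]`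
(`∀ P, nP = O → P = O`) yields the hypothesis `htors` of
`natCard_selmerGroup_le_prime_mul_of_natCard_torsion_eq_one` / `natCard_selmerGroup_shortWeierstrass_le_mul`
at the place `v ∋ p` — the one-line discharge of the binder `hker` of `bsz_rankLeOne_cRank_of_pieces`
from the summit cone's `localTorsion_eq_zero_of_mult` or from the Tate test
`forall_prime_smul_eq_zero_iff_not_exists_pow_eq_tateParameter`.
[cite: BhargavaSkinner2014, Thm 7 (ii) and proof of Lemma 16] -/
theorem natCard_ker_nsmul_adicCompletion_eq_one_of_forall_padic (hpv : (p : 𝓞 ℚ) ∈ v.asIdeal)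
    {n : ℕ} (h : ∀ P : (W.baseChange ℚ_[p]).toAffine.Point, n • P = 0 → P = 0) :
    Nat.card (nsmulAddMonoidHom n :
      (W.baseChange (v.adicCompletion ℚ)).toAffine.Point →+ _).ker = 1 :=
  (W.natCard_ker_nsmul_adicCompletion_eq_one_iff hpv n).mpr h

end Transport

end WeierstrassCurve

end
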